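import Mathlib
import HarnessLib
import Literature.MathematicalPhysics.StatisticalMechanics.MuGSC
import Literature.Geometry.DiscreteGeometry.KissingPatterns
import Summits.AtomisticToContinuum.Statement
import Summits.AtomisticToContinuum.Crystallization.Theorems.OverbindingBudgetPatchTransport

/-!
# The two recurrence stubs of line «SealedWallCut» on `RobustDefectLimitWindows` (route OverbindingBudget,
item stmt-AtomisticToContinuum-31280), BY NAME — from the patch-transport lemma

`stub_burgersRecurrence` (a finite non-developable patch of `t`-robustly clean sites recurs, non-developable, at margin
`t/2`, within bounded distance of every site) and `stub_sealedRecurrence` (a `(t, -t)`-sealed pair of width `≤ W₀` recurs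
as a `(t/2, -t/2)`-sealed pair of width `≤ W₀ + 1`) of the registered line
`Cruxes/RobustDefectLimitWindows/Lines/sealedwall.lean` (v5, decomp-a2c lens 4, generation 12), with their registered
signatures (node predicates expanded).  Both are corollaries of `Theorems.OverbindingBudgetPatchTransport.cleanT_transport`:
forward (`t ↦ t/2`) for clean sites, and backward (`-t/2 ↦ -t`) for the sites of a putative short loosened contact path,
where the exact `1.02a`-shell threshold is protected by the least gap `θ > 0` above `1.02a` among the pair distances of
the finite source patch (`exists_gap_above`, precision `ε ≤ θ/3`).  Contacts are matching-invariant
(`contact_transfer`), so developability onto a perfect Barlow crystal pulls back.  No energy, no ground state: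
uniform discreteness + two-way recurrence only. [folklore techniques]
-/

namespace Summit.AtomisticToContinuum.Crystallization.Theorems.OverbindingBudgetPatchTransportRecurrence

open Literature.MathematicalPhysics.StatisticalMechanics Literature.Geometry.DiscreteGeometry Metric
open Summit.AtomisticToContinuum.Crystallization.Theorems.OverbindingBudgetPatchTransport


/-! ## Scale, gaps and contacts -/

/-- In a `δ`-separated set, a `t`-robustly clean site with `t > 0` fixes the sign of the scale and caps the margin:
`0 < a` and `t ≤ a/50` (its inner shell is non-empty). [folklore] -/
theorem cleanT_scale {Y : Set (EuclideanSpace ℝ (Fin 3))} {a t : ℝ} {y : (EuclideanSpace ℝ (Fin 3))} (ht : 0 < t) (hc : ({w ∈ Y | w ≠ y ∧ dist y w ≤ a * (1 + 1 / 50) - t}.ncard = 12 ∧ (∀ w ∈ Y, w ≠ y → a * (1 - 1 / 50) + t ≤ dist y w ∧ (dist y w ≤ a * (1 + 1 / 50) - t ∨ a * (63 / 50) + t ≤ dist y w)) ∧ (∃ T : Finset (EuclideanSpace ℝ (Fin 3)), (↑T : Set (EuclideanSpace ℝ (Fin 3))) = (fun w => a⁻¹ • (w - y)) '' {w ∈ Y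 | w ≠ y ∧ dist y w ≤ a * (1 + 1 / 50)} ∧ (Literature.Geometry.DiscreteGeometry.ShellCloseTo (1 / 5 - t) T Literature.Geometry.DiscreteGeometry.fccKissingPattern ∨ Literature.Geometry.DiscreteGeometry.ShellCloseTo (1 / 5 - t) T Literature.Geometry.DiscreteGeometry.hcpKissingPattern)))) :
    0 < a ∧ t ≤ a / 50 := by
  obtain ⟨hc1, hc2, -⟩ := hc
  have hne : {w ∈ Y | w ≠ y ∧ dist y w ≤ a * (1 + 1 / 50) - t}.Nonempty :=
    Set.nonempty_of_ncard_ne_zero (by rw [hc1]; norm_num)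
  obtain ⟨w, hwY, hwy, hwd⟩ := hne
  have h1 := (hc2 w hwY hwy).1
  constructor <;> linarith

/-- Above any threshold `c`, the pair distances of a finite set leave a gap `θ > 0`. [folklore] -/
theorem exists_gap_above {F : Set (EuclideanSpace ℝ (Fin 3))} (hF : F.Finite) (c : ℝ) :
    ∃ θ : ℝ, 0 < θ ∧ ∀ z ∈ F, ∀ w ∈ F, dist z w ≤ c ∨ c + θ ≤ dist z w := by
  classical
  set D : Finset ((EuclideanSpace ℝ (Fin 3)) × (EuclideanSpace ℝ (Fin 3))) := (hF.toFinset ×ˢ hF.toFinset).filter (fun zw => c < dist zw.1 zw.2) with hD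
  have hmemD : ∀ z ∈ F, ∀ w ∈ F, c < dist z w → (z, w) ∈ D := by
    intro z hz w hw hzw
    rw [hD, Finset.mem_filter, Finset.mem_product, Set.Finite.mem_toFinset, Set.Finite.mem_toFinset]
    exact ⟨⟨hz, hw⟩, hzw⟩
  by_cases hne : D.Nonempty
  · obtain ⟨zw₀, h₀, hmin⟩ := D.exists_min_image (fun zw => dist zw.1 zw.2) hne
    have h₀' : c < dist zw₀.1 zw₀.2 := by
      rw [hD, Finset.mem_filter] at h₀
      exact h₀.2
    refine ⟨dist zw₀.1 zw₀.2 - c, by linarith, fun z hz w hw => ?_⟩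
    by_cases hzw : dist z w ≤ c
    · exact Or.inl hzw
    · right
      have := hmin (z, w) (hmemD z hz w hw (lt_of_not_ge hzw))
      simp only at this
      linarith
  · refine ⟨1, one_pos, fun z hz w hw => ?_⟩
    by_contra h
    push Not at h
    exact hne ⟨(z, w), hmemD z hz w hw h.1⟩

/-- Contacts at threshold `1.02a` between a `t`-robustly clean site (`t ≥ 2ε ≥ 0`) and the other sites
are invariant under a matching with error `ε` (`2ε < δ`). [folklore] -/
theorem contact_transfer {Y : Set (EuclideanSpace ℝ (Fin 3))} {δ ε a t : ℝ} {b₁ b₂ y₁ y₁' y₂ y₂' : (EuclideanSpace ℝ (Fin 3))}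
    (hsep : ∀ x ∈ Y, ∀ z ∈ Y, x ≠ z → δ ≤ dist x z) (hεδ : 2 * ε < δ) (ha : 0 < a) (hε0 : 0 ≤ ε)
    (h2ε : 2 * ε ≤ t) (hy₁ : y₁ ∈ Y) (hy₂ : y₂ ∈ Y) (hy₁' : y₁' ∈ Y) (hy₂' : y₂' ∈ Y)
    (hm₁ : dist (y₁' - b₂) (y₁ - b₁) ≤ ε) (hm₂ : dist (y₂' - b₂) (y₂ - b₁) ≤ ε)
    (hc2 : ∀ w ∈ Y, w ≠ y₁ → a * (1 - 1 / 50) + t ≤ dist y₁ w ∧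
      (dist y₁ w ≤ a * (1 + 1 / 50) - t ∨ a * (63 / 50) + t ≤ dist y₁ w)) :
    (y₁ ≠ y₂ ∧ dist y₁ y₂ ≤ a * (1 + 1 / 50)) ↔ (y₁' ≠ y₂' ∧ dist y₁' y₂' ≤ a * (1 + 1 / 50)) := by
  have hd := abs_le.1 (dist_distort hm₁ hm₂)
  constructor
  · rintro ⟨hne, hle⟩
    refine ⟨fun heq => hne (match_unique_src hsep hεδ hy₁ hy₂ hm₁ (heq ▸ hm₂)), ?_⟩
    rcases (hc2 y₂ hy₂ (Ne.symm hne)).2 with h | h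
    · linarith [hd.2]
    · exfalso; linarith
  · rintro ⟨hne, hle⟩
    have hne' : y₁ ≠ y₂ := fun heq => hne (match_unique_tgt hsep hεδ hy₁' hy₂' hm₁ (heq ▸ hm₂))
    refine ⟨hne', ?_⟩
    rcases (hc2 y₂ hy₂ (Ne.symm hne')).2 with h | h
    · linarith
    · exfalso; linarith [hd.1]

/-! ## The two registered recurrence stubs of line «SealedWallCut», BY NAME (signatures verbatim) -/

/-- Registered stub `stub_burgersRecurrence` of `Cruxes/RobustDefectLimitWindows/Lines/sealedwall.lean` (v5), verbatim
signature: in a uniformly discrete two-way recurrent set, a finite non-developable patch of `t`-robustly clean sites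
recurs, as a non-developable patch of at most as many `t/2`-robustly clean sites, within bounded distance of every
site.  Proof: patch transport forward (`cleanT_transport`, `t' = t/2`) + contact invariance (`contact_transfer`). -/
theorem stub_burgersRecurrence :
    ∀ Y : Set (EuclideanSpace ℝ (Fin 3)), Literature.MathematicalPhysics.StatisticalMechanics.UniformlyDiscrete Y → (∀ R ε : ℝ, 0 < ε → ∃ L : ℝ, ∀ p ∈ Y, ∀ q ∈ Y, ∃ q' ∈ Y, dist q' q ≤ L ∧ (∀ y ∈ Y, dist y p ≤ R → ∃ y' ∈ Y, dist (y' - q') (y - p) ≤ ε) ∧ (∀ y' ∈ Y, dist y' q' ≤ R → ∃ y ∈ Y, dist (y' - q') (y - p) ≤ ε)) → ∀ a t : ℝ, 0 < t → ∀ S : Finset (EuclideanSpace ℝ (Fin 3)), (↑S : Set (EuclideanSpace ℝ (Fin 3))) ⊆ Y → (∀ y ∈ S, ({w ∈ Y | w ≠ y ∧ dist y w ≤ a * (1 + 1 / 50) - t}.ncard = 12 ∧ (∀ w ∈ Y, w ≠ y → a * (1 - 1 / 50) + t ≤ dist y w ∧ (dist y w ≤ a * (1 + 1 / 50) - t ∨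 a * (63 / 50) + t ≤ dist y w)) ∧ (∃ T : Finset (EuclideanSpace ℝ (Fin 3)), (↑T : Set (EuclideanSpace ℝ (Fin 3))) = (fun w => a⁻¹ • (w - y)) '' {w ∈ Y | w ≠ y ∧ dist y w ≤ a * (1 + 1 / 50)} ∧ (Literature.Geometry.DiscreteGeometry.ShellCloseTo (1 / 5 - t) T Literature.Geometry.DiscreteGeometry.fccKissingPattern ∨ Literature.Geometry.DiscreteGeometry.ShellCloseTo (1 / 5 - t) T Literature.Geometry.DiscreteGeometry.hcpKissingPattern)))) → ¬ (∃ W : Set (EuclideanSpace ℝ (Fin 3)), (∀ w ∈ W, ({v ∈ W | v ≠ w ∧ dist w v ≤ a}.ncard = 12 ∧ (∀ v ∈ W, v ≠ w → a ≤ dist w v ∧ (dist w v ≤ a ∨ a * (7 / 5) ≤ dist w v)) ∧ (∃ T : Finset (EuclideanSpace ℝ (Fin 3)), (↑T : Set (EuclideanSpace ℝ (Fin 3))) = (fun v => a⁻¹ • (v - w)) '' {v ∈ W | v ≠ w ∧ dist w v ≤ a} ∧ (Literature.Geometry.DiscreteGeometry.ShellCloseTo 0 T Literature.Geometry.DiscreteGeometry.fccKissingPattern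 ∨ Literature.Geometry.DiscreteGeometry.ShellCloseTo 0 T Literature.Geometry.DiscreteGeometry.hcpKissingPattern)))) ∧ ∃ u : EuclideanSpace ℝ (Fin 3) → EuclideanSpace ℝ (Fin 3), Set.InjOn u (↑S : Set (EuclideanSpace ℝ (Fin 3))) ∧ (∀ y ∈ S, u y ∈ W) ∧ ∀ y ∈ S, ∀ y' ∈ S, ((y ≠ y' ∧ dist y y' ≤ a * (1 + 1 / 50)) ↔ (u y ≠ u y' ∧ dist (u y) (u y') ≤ a * (1 + 1 / 50)))) → (∃ L M : ℝ, ∀ p ∈ Y, ∃ S' : Finset (EuclideanSpace ℝ (Fin 3)), (↑S' : Set (EuclideanSpace ℝ (Fin 3))) ⊆ Y ∧ (S'.card : ℝ) ≤ M ∧ (∀ y ∈ S', dist y p ≤ L) ∧ (∀ y ∈ S', ({w ∈ Y | w ≠ y ∧ dist y w ≤ a * (1 + 1 / 50) - t / 2}.ncard = 12 ∧ (∀ w ∈ Y, w ≠ y → a * (1 - 1 / 50) + t / 2 ≤ dist y w ∧ (dist y w ≤ a * (1 + 1 / 50) - t / 2 ∨ a * (63 / 50) + t / 2 ≤ dist y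 w)) ∧ (∃ T : Finset (EuclideanSpace ℝ (Fin 3)), (↑T : Set (EuclideanSpace ℝ (Fin 3))) = (fun w => a⁻¹ • (w - y)) '' {w ∈ Y | w ≠ y ∧ dist y w ≤ a * (1 + 1 / 50)} ∧ (Literature.Geometry.DiscreteGeometry.ShellCloseTo (1 / 5 - t / 2) T Literature.Geometry.DiscreteGeometry.fccKissingPattern ∨ Literature.Geometry.DiscreteGeometry.ShellCloseTo (1 / 5 - t / 2) T Literature.Geometry.DiscreteGeometry.hcpKissingPattern)))) ∧ ¬ (∃ W : Set (EuclideanSpace ℝ (Fin 3)), (∀ w ∈ W, ({v ∈ W | v ≠ w ∧ dist w v ≤ a}.ncard = 12 ∧ (∀ v ∈ W, v ≠ w → a ≤ dist w v ∧ (dist w v ≤ a ∨ a * (7 / 5) ≤ dist w v)) ∧ (∃ T : Finset (EuclideanSpace ℝ (Fin 3)), (↑T : Set (EuclideanSpace ℝ (Fin 3))) = (fun v => a⁻¹ • (v - w)) '' {v ∈ W | v ≠ w ∧ dist w v ≤ a} ∧ (Literature.Geometry.DiscreteGeometry.ShellCloseTo 0 T Literature.Geometry.DiscreteGeometry.fccKissingPattern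 ∨ Literature.Geometry.DiscreteGeometry.ShellCloseTo 0 T Literature.Geometry.DiscreteGeometry.hcpKissingPattern)))) ∧ ∃ u : EuclideanSpace ℝ (Fin 3) → EuclideanSpace ℝ (Fin 3), Set.InjOn u (↑S' : Set (EuclideanSpace ℝ (Fin 3))) ∧ (∀ y ∈ S', u y ∈ W) ∧ ∀ y ∈ S', ∀ y' ∈ S', ((y ≠ y' ∧ dist y y' ≤ a * (1 + 1 / 50)) ↔ (u y ≠ u y' ∧ dist (u y) (u y') ≤ a * (1 + 1 / 50))))) := by
  intro Y hUD hrec a t ht S hSY hS hnd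
  classical
  -- an empty patch is developable, so `S` is non-empty: fix `y₀ ∈ S`
  rcases S.eq_empty_or_nonempty with hSe | ⟨y₀, hy₀⟩
  · exfalso
    apply hnd
    subst hSe
    refine ⟨∅, fun w hw => ?_, id, ?_, ?_, ?_⟩
    · simp at hw
    · simp
    · simp
    · simp
  obtain ⟨δ, hδ, hsep⟩ := hUD
  have hy₀Y : y₀ ∈ Y := hSY (Finset.mem_coe.2 hy₀)
  obtain ⟨ha, hta⟩ := cleanT_scale ht (hS y₀ hy₀)
  -- patch radius `D + 2a` about `y₀`, precision `ε`
  set D : ℝ := ∑ s ∈ S, dist s y₀ with hD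
  have hDs : ∀ s ∈ S, dist s y₀ ≤ D := fun s hs =>
    Finset.single_le_sum (f := fun s => dist s y₀) (fun _ _ => dist_nonneg) hs
  have hD0 : 0 ≤ D := Finset.sum_nonneg fun _ _ => dist_nonneg
  set ε : ℝ := min (min (t / 8) (a * t / 8)) (min (δ / 3) (1 / 4)) with hε
  have hε1 : ε ≤ t / 8 := (min_le_left _ _).trans (min_le_left _ _)
  have hε2 : ε ≤ a * t / 8 := (min_le_left _ _).trans (min_le_right _ _)
  have hε3 : ε ≤ δ / 3 := (min_le_right _ _).trans (min_le_left _ _)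
  have hε5 : ε ≤ 1 / 4 := (min_le_right _ _).trans (min_le_right _ _)
  have hat : 0 < a * t := mul_pos ha ht
  have hε0 : 0 < ε := lt_min (lt_min (by linarith) (by linarith)) (lt_min (by linarith) (by norm_num))
  have hεδ : 2 * ε < δ := by linarith
  obtain ⟨L, hL⟩ := hrec (D + 2 * a) ε hε0
  refine ⟨L + D + 1, S.card, fun p hp => ?_⟩
  obtain ⟨q', hq'Y, hq'p, hfwd, hbwd⟩ := hL y₀ hy₀Y p hp
  have hfwd' := hfwd
  choose! φ hφY hφd using hfwd'
  have hSR : ∀ s ∈ S, dist s y₀ ≤ D + 2 * a := fun s hs => by linarith [hDs s hs]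
  have hSYm : ∀ s ∈ S, s ∈ Y := fun s hs => hSY (Finset.mem_coe.2 hs)
  have hφS : ∀ s ∈ S, φ s ∈ Y := fun s hs => hφY s (hSYm s hs) (hSR s hs)
  have hφdS : ∀ s ∈ S, dist (φ s - q') (s - y₀) ≤ ε := fun s hs => hφd s (hSYm s hs) (hSR s hs)
  refine ⟨S.image φ, ?_, ?_, ?_, ?_, ?_⟩
  · -- the transported patch lies in `Y`
    intro y' hy'
    rw [Finset.coe_image] at hy'
    obtain ⟨s, hs, rfl⟩ := hy'
    exact hφS s hs
  · -- at most `S.card` sites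
    exact_mod_cast Finset.card_image_le
  · -- within `L + D + 1` of `p`
    intro y' hy'
    obtain ⟨s, hs, rfl⟩ := Finset.mem_image.1 hy'
    have h1 := (abs_le.1 (abs_dist_sub_dist_le (hφdS s hs))).2
    have h2 := dist_triangle (φ s) q' p
    rw [dist_comm (φ s) q'] at h2
    have h3 := hDs s hs
    rw [dist_comm s y₀] at h3
    linarith
  · -- `t/2`-robustly clean (patch transport, forward)
    intro y' hy'
    obtain ⟨s, hs, rfl⟩ := Finset.mem_image.1 hy'
    exact cleanT_transport (t' := t / 2) hsep hε0.le hεδ hfwd hbwd ha (by linarith) (by linarith) hta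
      (by linarith) (by linarith) (hSYm s hs) (hφS s hs) (hφdS s hs) (by linarith [hDs s hs])
      (Or.inl (by linarith)) (hS s hs)
  · -- non-developability pulls back along the matching (contacts are matching-invariant)
    rintro ⟨W, hW, u, huinj, huW, hiff⟩
    apply hnd
    refine ⟨W, hW, fun y => u (φ y), ?_, ?_, ?_⟩
    · intro y₁ hy₁ y₂ hy₂ heq
      have hy₁S : y₁ ∈ S := Finset.mem_coe.1 hy₁
      have hy₂S : y₂ ∈ S := Finset.mem_coe.1 hy₂
      have hφeq : φ y₁ = φ y₂ :=
        huinj (Finset.mem_coe.2 (Finset.mem_image_of_mem φ hy₁S))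
          (Finset.mem_coe.2 (Finset.mem_image_of_mem φ hy₂S)) heq
      have hm₂ : dist (φ y₁ - q') (y₂ - y₀) ≤ ε := by rw [hφeq]; exact hφdS y₂ hy₂S
      exact match_unique_src hsep hεδ (hSYm y₁ hy₁S) (hSYm y₂ hy₂S) (hφdS y₁ hy₁S) hm₂
    · intro y hy
      exact huW (φ y) (Finset.mem_image_of_mem φ hy)
    · intro y₁ hy₁ y₂ hy₂
      rw [contact_transfer hsep hεδ ha hε0.le (by linarith) (hSYm y₁ hy₁) (hSYm y₂ hy₂) (hφS y₁ hy₁) (hφS y₂ hy₂)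
        (hφdS y₁ hy₁) (hφdS y₂ hy₂) (hS y₁ hy₁).2.1]
      exact hiff (φ y₁) (Finset.mem_image_of_mem φ hy₁) (φ y₂) (Finset.mem_image_of_mem φ hy₂)

/-- Registered stub `stub_sealedRecurrence` of `Cruxes/RobustDefectLimitWindows/Lines/sealedwall.lean` (v5), verbatim
signature: a `(t, -t)`-sealed pair of width `≤ W₀` (two `t`-robustly clean sites joined by no contact path of `≤ P₀`
steps through `(-t)`-loosened clean sites) recurs as a `(t/2, -t/2)`-sealed pair of width `≤ W₀ + 1` within bounded
distance of every site.  Proof: patch transport forward for the pair and BACKWARD for a putative short loosened path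
(`t = -t/2 ↦ t' = -t`), the exact-shell threshold being protected by the least gap `θ` above `1.02a` among the pair
distances of the finite source patch (`ε ≤ θ/3`). -/
theorem stub_sealedRecurrence :
    ∀ Y : Set (EuclideanSpace ℝ (Fin 3)), Literature.MathematicalPhysics.StatisticalMechanics.UniformlyDiscrete Y → (∀ R ε : ℝ, 0 < ε → ∃ L : ℝ, ∀ p ∈ Y, ∀ q ∈ Y, ∃ q' ∈ Y, dist q' q ≤ L ∧ (∀ y ∈ Y, dist y p ≤ R → ∃ y' ∈ Y, dist (y' - q') (y - p) ≤ ε) ∧ (∀ y' ∈ Y, dist y' q' ≤ R → ∃ y ∈ Y, dist (y' - q') (y - p) ≤ ε)) → ∀ a t W₀ : ℝ, ∀ P₀ : ℕ, 0 < t → ∀ y ∈ Y, ∀ y' ∈ Y, ({w ∈ Y | w ≠ y ∧ dist y w ≤ a * (1 + 1 / 50) - t}.ncard = 12 ∧ (∀ w ∈ Y, w ≠ y → a * (1 - 1 / 50) + t ≤ dist y w ∧ (dist y w ≤ a * (1 + 1 / 50) - t ∨ a * (63 / 50) + t ≤ dist y w)) ∧ (∃ T : Finset (EuclideanSpace ℝ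 (Fin 3)), (↑T : Set (EuclideanSpace ℝ (Fin 3))) = (fun w => a⁻¹ • (w - y)) '' {w ∈ Y | w ≠ y ∧ dist y w ≤ a * (1 + 1 / 50)} ∧ (Literature.Geometry.DiscreteGeometry.ShellCloseTo (1 / 5 - t) T Literature.Geometry.DiscreteGeometry.fccKissingPattern ∨ Literature.Geometry.DiscreteGeometry.ShellCloseTo (1 / 5 - t) T Literature.Geometry.DiscreteGeometry.hcpKissingPattern))) → ({w ∈ Y | w ≠ y' ∧ dist y' w ≤ a * (1 + 1 / 50) - t}.ncard = 12 ∧ (∀ w ∈ Y, w ≠ y' → a * (1 - 1 / 50) + t ≤ dist y' w ∧ (dist y' w ≤ a * (1 + 1 / 50) - t ∨ a * (63 / 50) + t ≤ dist y' w)) ∧ (∃ T : Finset (EuclideanSpace ℝ (Fin 3)), (↑T : Set (EuclideanSpace ℝ (Fin 3))) = (fun w => a⁻¹ • (w - y')) '' {w ∈ Y | w ≠ y' ∧ dist y' w ≤ a * (1 + 1 / 50)} ∧ (Literature.Geometry.DiscreteGeometry.ShellCloseTo (1 / 5 - t) T Literature.Geometry.DiscreteGeometry.fccKissingPattern ∨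 Literature.Geometry.DiscreteGeometry.ShellCloseTo (1 / 5 - t) T Literature.Geometry.DiscreteGeometry.hcpKissingPattern))) → dist y y' ≤ W₀ → ¬ (∃ n : ℕ, n ≤ P₀ ∧ ∃ z : ℕ → EuclideanSpace ℝ (Fin 3), z 0 = y ∧ z n = y' ∧ (∀ i : ℕ, i ≤ n → z i ∈ Y ∧ ({w ∈ Y | w ≠ (z i) ∧ dist (z i) w ≤ a * (1 + 1 / 50) - (-t)}.ncard = 12 ∧ (∀ w ∈ Y, w ≠ (z i) → a * (1 - 1 / 50) + (-t) ≤ dist (z i) w ∧ (dist (z i) w ≤ a * (1 + 1 / 50) - (-t) ∨ a * (63 / 50) + (-t) ≤ dist (z i) w)) ∧ (∃ T : Finset (EuclideanSpace ℝ (Fin 3)), (↑T : Set (EuclideanSpace ℝ (Fin 3))) = (fun w => a⁻¹ • (w - (z i))) '' {w ∈ Y | w ≠ (z i) ∧ dist (z i) w ≤ a * (1 + 1 / 50)} ∧ (Literature.Geometry.DiscreteGeometry.ShellCloseTo (1 / 5 - (-t)) T Literature.Geometry.DiscreteGeometry.fccKissingPattern ∨ Literature.Geometry.DiscreteGeometry.ShellCloseTo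 (1 / 5 - (-t)) T Literature.Geometry.DiscreteGeometry.hcpKissingPattern)))) ∧ (∀ i : ℕ, i < n → (z i ≠ z (i + 1) ∧ dist (z i) (z (i + 1)) ≤ a * (1 + 1 / 50) - (-t)))) → (∃ L : ℝ, ∀ p ∈ Y, ∃ y ∈ Y, ∃ y' ∈ Y, dist y p ≤ L ∧ ({w ∈ Y | w ≠ y ∧ dist y w ≤ a * (1 + 1 / 50) - t / 2}.ncard = 12 ∧ (∀ w ∈ Y, w ≠ y → a * (1 - 1 / 50) + t / 2 ≤ dist y w ∧ (dist y w ≤ a * (1 + 1 / 50) - t / 2 ∨ a * (63 / 50) + t / 2 ≤ dist y w)) ∧ (∃ T : Finset (EuclideanSpace ℝ (Fin 3)), (↑T : Set (EuclideanSpace ℝ (Fin 3))) = (fun w => a⁻¹ • (w - y)) '' {w ∈ Y | w ≠ y ∧ dist y w ≤ a * (1 + 1 / 50)} ∧ (Literature.Geometry.DiscreteGeometry.ShellCloseTo (1 / 5 - t / 2) T Literature.Geometry.DiscreteGeometry.fccKissingPattern ∨ Literature.Geometry.DiscreteGeometry.ShellCloseTo (1 / 5 - t / 2) T Literature.Geometry.DiscreteGeometry.hcpKissingPattern)))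 ∧ ({w ∈ Y | w ≠ y' ∧ dist y' w ≤ a * (1 + 1 / 50) - t / 2}.ncard = 12 ∧ (∀ w ∈ Y, w ≠ y' → a * (1 - 1 / 50) + t / 2 ≤ dist y' w ∧ (dist y' w ≤ a * (1 + 1 / 50) - t / 2 ∨ a * (63 / 50) + t / 2 ≤ dist y' w)) ∧ (∃ T : Finset (EuclideanSpace ℝ (Fin 3)), (↑T : Set (EuclideanSpace ℝ (Fin 3))) = (fun w => a⁻¹ • (w - y')) '' {w ∈ Y | w ≠ y' ∧ dist y' w ≤ a * (1 + 1 / 50)} ∧ (Literature.Geometry.DiscreteGeometry.ShellCloseTo (1 / 5 - t / 2) T Literature.Geometry.DiscreteGeometry.fccKissingPattern ∨ Literature.Geometry.DiscreteGeometry.ShellCloseTo (1 / 5 - t / 2) T Literature.Geometry.DiscreteGeometry.hcpKissingPattern))) ∧ dist y y' ≤ W₀ + 1 ∧ ¬ (∃ n : ℕ, n ≤ P₀ ∧ ∃ z : ℕ → EuclideanSpace ℝ (Fin 3), z 0 = y ∧ z n = y' ∧ (∀ i : ℕ, i ≤ n → z i ∈ Y ∧ ({w ∈ Y | w ≠ (z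 i) ∧ dist (z i) w ≤ a * (1 + 1 / 50) - (-(t / 2))}.ncard = 12 ∧ (∀ w ∈ Y, w ≠ (z i) → a * (1 - 1 / 50) + (-(t / 2)) ≤ dist (z i) w ∧ (dist (z i) w ≤ a * (1 + 1 / 50) - (-(t / 2)) ∨ a * (63 / 50) + (-(t / 2)) ≤ dist (z i) w)) ∧ (∃ T : Finset (EuclideanSpace ℝ (Fin 3)), (↑T : Set (EuclideanSpace ℝ (Fin 3))) = (fun w => a⁻¹ • (w - (z i))) '' {w ∈ Y | w ≠ (z i) ∧ dist (z i) w ≤ a * (1 + 1 / 50)} ∧ (Literature.Geometry.DiscreteGeometry.ShellCloseTo (1 / 5 - (-(t / 2))) T Literature.Geometry.DiscreteGeometry.fccKissingPattern ∨ Literature.Geometry.DiscreteGeometry.ShellCloseTo (1 / 5 - (-(t / 2))) T Literature.Geometry.DiscreteGeometry.hcpKissingPattern)))) ∧ (∀ i : ℕ, i < n → (z i ≠ z (i + 1) ∧ dist (z i) (z (i + 1)) ≤ a * (1 + 1 / 50) - (-(t / 2)))))) := by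
  intro Y hUD hrec a t W₀ P₀ ht y₁ hy₁ y₂ hy₂ hc₁ hc₂ hW hns
  obtain ⟨δ, hδ, hsep⟩ := id hUD
  obtain ⟨ha, hta⟩ := cleanT_scale ht hc₁
  have hW0 : 0 ≤ W₀ := dist_nonneg.trans hW
  have hP0 : (0 : ℝ) ≤ P₀ := Nat.cast_nonneg _
  have hP2a : 0 ≤ (P₀ : ℝ) * (2 * a) := mul_nonneg hP0 (by linarith)
  -- patch radius about `y₁`: all sites of a `P₀`-step loosened path, their shells, and the sealed partner
  set R : ℝ := (P₀ : ℝ) * (2 * a) + W₀ + 4 * a with hR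
  -- the least gap above `1.02a` among pair distances of the (finite) source patch
  obtain ⟨θ, hθ, hgap⟩ := exists_gap_above (hUD.finite_inter_closedBall y₁ R) (a * (1 + 1 / 50))
  set ε : ℝ := min (min (min (t / 8) (a * t / 8)) (min (δ / 3) (θ / 3))) (1 / 4) with hε
  have hε1 : ε ≤ t / 8 := (min_le_left _ _).trans ((min_le_left _ _).trans (min_le_left _ _))
  have hε2 : ε ≤ a * t / 8 := (min_le_left _ _).trans ((min_le_left _ _).trans (min_le_right _ _))
  have hε3 : ε ≤ δ / 3 := (min_le_left _ _).trans ((min_le_right _ _).trans (min_le_left _ _))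
  have hε4 : ε ≤ θ / 3 := (min_le_left _ _).trans ((min_le_right _ _).trans (min_le_right _ _))
  have hε5 : ε ≤ 1 / 4 := min_le_right _ _
  have hat : 0 < a * t := mul_pos ha ht
  have hε0 : 0 < ε :=
    lt_min (lt_min (lt_min (by linarith) (by linarith)) (lt_min (by linarith) (by linarith))) (by norm_num)
  have hεδ : 2 * ε < δ := by linarith
  obtain ⟨L, hL⟩ := hrec R ε hε0
  refine ⟨L, fun p hp => ?_⟩
  obtain ⟨q', hq'Y, hq'p, hfwd, hbwd⟩ := hL y₁ hy₁ p hp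
  have hfwd' := hfwd
  have hbwd' := hbwd
  choose! φ hφY hφd using hfwd'
  choose! ψ hψY hψd using hbwd'
  have h11 : dist (q' - q') (y₁ - y₁) ≤ ε := by simp [hε0.le]
  have hW' : dist y₂ y₁ ≤ W₀ := by rw [dist_comm]; exact hW
  have hy₂R : dist y₂ y₁ ≤ R := by linarith
  have hφy₂Y : φ y₂ ∈ Y := hφY y₂ hy₂ hy₂R
  have hφy₂d : dist (φ y₂ - q') (y₂ - y₁) ≤ ε := hφd y₂ hy₂ hy₂R
  refine ⟨q', hq'Y, φ y₂, hφy₂Y, hq'p, ?_, ?_, ?_, ?_⟩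
  · -- the base site stays `t/2`-robustly clean
    exact cleanT_transport (t' := t / 2) hsep hε0.le hεδ hfwd hbwd ha (by linarith) (by linarith) hta
      (by linarith) (by linarith) hy₁ hq'Y h11 (by rw [dist_self]; linarith) (Or.inl (by linarith)) hc₁
  · -- so does the partner
    exact cleanT_transport (t' := t / 2) hsep hε0.le hεδ hfwd hbwd ha (by linarith) (by linarith) hta
      (by linarith) (by linarith) hy₂ hφy₂Y hφy₂d (by linarith [hW']) (Or.inl (by linarith)) hc₂
  · -- width grows by at most `2ε ≤ 1`
    have := (abs_le.1 (dist_distort h11 hφy₂d)).2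
    linarith
  · -- a short `(-t/2)`-loosened contact path downstairs would pull back to a `(-t)`-loosened one upstairs
    rintro ⟨n, hn, z, hz0, hzn, hsite, hstep⟩
    apply hns
    -- path sites stay within `P₀ · 2a` of `q'`
    have hpath : ∀ i : ℕ, i ≤ n → dist (z i) q' ≤ (i : ℝ) * (a * (1 + 1 / 50) + t / 2) := by
      intro i
      induction i with
      | zero =>
        intro _
        rw [hz0, dist_self]
        simp
      | succ k ih =>
        intro hk
        have hk' : k < n := Nat.lt_of_succ_le hk
        have h1 := ih hk'.le
        have h2 := (hstep k hk').2
        have h3 := dist_triangle (z (k + 1)) (z k) q'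
        rw [dist_comm (z (k + 1)) (z k)] at h3
        push_cast
        nlinarith
    have hρ : ∀ i : ℕ, i ≤ n → dist (z i) q' ≤ (P₀ : ℝ) * (2 * a) := by
      intro i hi
      have h2 : (i : ℝ) ≤ P₀ := by exact_mod_cast hi.trans hn
      have h4 : a * (1 + 1 / 50) + t / 2 ≤ 2 * a := by linarith
      have h5 : 0 ≤ a * (1 + 1 / 50) + t / 2 := by linarith
      calc dist (z i) q' ≤ (i : ℝ) * (a * (1 + 1 / 50) + t / 2) := hpath i hi
        _ ≤ (P₀ : ℝ) * (a * (1 + 1 / 50) + t / 2) := mul_le_mul_of_nonneg_right h2 h5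
        _ ≤ (P₀ : ℝ) * (2 * a) := mul_le_mul_of_nonneg_left h4 hP0
    -- the matching read backwards (base points `q' ↦ y₁`)
    have hex₁' : ∀ w ∈ Y, dist w q' ≤ R → ∃ w' ∈ Y, dist (w' - y₁) (w - q') ≤ ε := by
      intro w hw hwR
      obtain ⟨w₀, hw₀, hd⟩ := hbwd w hw hwR
      exact ⟨w₀, hw₀, by rw [dist_comm]; exact hd⟩
    have hex₂' : ∀ w' ∈ Y, dist w' y₁ ≤ R → ∃ w ∈ Y, dist (w' - y₁) (w - q') ≤ ε := by
      intro w' hw' hw'R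
      obtain ⟨w₀, hw₀, hd⟩ := hfwd w' hw' hw'R
      exact ⟨w₀, hw₀, by rw [dist_comm]; exact hd⟩
    have hzY : ∀ i : ℕ, i ≤ n → z i ∈ Y := fun i hi => (hsite i hi).1
    have hzR : ∀ i : ℕ, i ≤ n → dist (z i) q' ≤ R := fun i hi => by linarith [hρ i hi]
    have hψzY : ∀ i : ℕ, i ≤ n → ψ (z i) ∈ Y := fun i hi => hψY (z i) (hzY i hi) (hzR i hi)
    have hψzd : ∀ i : ℕ, i ≤ n → dist (ψ (z i) - y₁) (z i - q') ≤ ε := fun i hi => by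
      rw [dist_comm]; exact hψd (z i) (hzY i hi) (hzR i hi)
    have hR0 : dist q' q' ≤ R := by rw [dist_self]; linarith
    refine ⟨n, hn, fun i => ψ (z i), ?_, ?_, ?_, ?_⟩
    · -- start: `ψ q' = y₁`
      show ψ (z 0) = y₁
      rw [hz0]
      have h1 : dist (y₁ - y₁) (q' - q') ≤ ε := by simp [hε0.le]
      have h2 : dist (ψ q' - y₁) (q' - q') ≤ ε := by rw [dist_comm]; exact hψd q' hq'Y hR0
      exact match_unique_tgt hsep hεδ (hψY q' hq'Y hR0) hy₁ h2 h1
    · -- end: `ψ (φ y₂) = y₂`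
      show ψ (z n) = y₂
      rw [hzn]
      have hφy₂R : dist (φ y₂) q' ≤ R := by
        have := (abs_le.1 (abs_dist_sub_dist_le hφy₂d)).2
        rw [dist_comm (φ y₂) q']
        linarith
      have h1 : dist (y₂ - y₁) (φ y₂ - q') ≤ ε := by rw [dist_comm]; exact hφy₂d
      have h2 : dist (ψ (φ y₂) - y₁) (φ y₂ - q') ≤ ε := by rw [dist_comm]; exact hψd (φ y₂) hφy₂Y hφy₂R
      exact match_unique_tgt hsep hεδ (hψY (φ y₂) hφy₂Y hφy₂R) hy₂ h2 h1
    · -- sites: pulled-back path sites are `(-t)`-loosened clean (patch transport, backwards; gap `θ`)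
      intro i hi
      beta_reduce
      refine ⟨hψzY i hi, ?_⟩
      have hbase := dist_base_le (hψzd i hi)
      have hthr : ∀ w' ∈ Y, w' ≠ ψ (z i) → dist (ψ (z i)) w' ≤ a * (1 + 1 / 50) ∨
          a * (1 + 1 / 50) + 2 * ε < dist (ψ (z i)) w' := by
        intro w' hw' _
        by_cases hfar : a * (1 + 1 / 50) + 2 * ε < dist (ψ (z i)) w'
        · exact Or.inr hfar
        · push Not at hfar
          left
          have hzi : dist (ψ (z i)) y₁ ≤ R := by linarith [hρ i hi]
          have hw'R : dist w' y₁ ≤ R := by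
            have := dist_triangle w' (ψ (z i)) y₁
            rw [dist_comm w' (ψ (z i))] at this
            linarith [hρ i hi]
          rcases hgap (ψ (z i)) ⟨hψzY i hi, Metric.mem_closedBall.2 hzi⟩ w'
              ⟨hw', Metric.mem_closedBall.2 hw'R⟩ with h | h
          · exact h
          · exfalso; linarith
      exact cleanT_transport (t := -(t / 2)) (t' := -t) hsep hε0.le hεδ hex₁' hex₂' ha (by linarith) (by linarith)
        (by linarith) (by linarith) (by linarith) (hzY i hi) (hψzY i hi) (hψzd i hi) (by linarith [hρ i hi])
        (Or.inr hthr) (hsite i hi).2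
    · -- steps: distinctness and lengths pull back (`2ε ≤ t/2`)
      intro i hi
      show ψ (z i) ≠ ψ (z (i + 1)) ∧ dist (ψ (z i)) (ψ (z (i + 1))) ≤ a * (1 + 1 / 50) - -t
      have hi1 : i + 1 ≤ n := hi
      obtain ⟨hne, hd⟩ := hstep i hi
      refine ⟨fun heq => hne ?_, ?_⟩
      · have hm₂ : dist (ψ (z i) - y₁) (z (i + 1) - q') ≤ ε := by rw [heq]; exact hψzd (i + 1) hi1
        exact match_unique_src hsep hεδ (hzY i hi.le) (hzY (i + 1) hi1) (hψzd i hi.le) hm₂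
      · have := (abs_le.1 (dist_distort (hψzd i hi.le) (hψzd (i + 1) hi1))).2
        linarith

end Summit.AtomisticToContinuum.Crystallization.Theorems.OverbindingBudgetPatchTransportRecurrence
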